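import Summits.BirchSwinnertonDyer.BirchSwinnertonDyer.Theorems.Rank2ObservatoryPadicAtlasKitMin3
import Summits.BirchSwinnertonDyer.BirchSwinnertonDyer.Theorems.Rank2ObservatoryPadicAtlasKitMin2
import Literature.NumberTheory.EllipticCurves.IwasawaLeadingTermOddPrime
import HarnessLib

/-!
# BirchSwinnertonDyer — rank ≥ 2 observatory: the `p`-adic row and the atlas kit at an ODD prime (`p = 3`)

HONEST FRAMING: per-curve certified theorems and census instruments; no claim on BSD in rank ≥ 2.

Module of the series `Rank2ObservatoryPadic*.lean` (generic squeeze `Rank2ObservatoryPadicRow.lean`,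
symbol tables `Rank2ObservatoryPadicSymbolTableL.lean`, atlas kit `Rank2ObservatoryPadicAtlasKit.lean`
/ `…KitMin2` / `…KitMin3`, machine-written atlas parts `Rank2ObservatoryPadicAtlasR2A*.lean`). The kit's
row theorem `padicRow_of_symbolCertL` and cell test `AtlasCell.check` ask `5 ≤ p` for ONE reason only:
the Perrin-Riou–Schneider fact `Schneider1985_order_charGenerator` (BMS Thm. 1.7) and the existence of
the canonical `p`-adic height datum (`exists_isCanonical_holds`) were typed for `p ≥ 5`. Everything
else in the chain is already stated for an odd prime: Kato's divisibility `kato_divisibility` and the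
rank bound `rank_eq_and_order_eq_of_certificate` (`p ≠ 2`), the kernel squeeze
`coeff_ne_zero_of_symbolCertL` (`validL` tests `p ≠ 2 ∧ p ∤ r!`, fine for `r = 2`, `p = 3`), the point
count `natCard_point_eq_one_add_eulerAffineCount` (`p ≠ 2`). The tree now holds the odd-prime
vocabulary (`IwasawaLeadingTermOddPrime.lean`: the named fact `Schneider1985_order_charGenerator_odd`
= BMS Thm. 1.7 at its printed generality `p > 2`; `PadicSigmaOddPrime.lean`: the named fact
`mazur_tate_sigma_exists_odd` = Mazur–Stein–Tate 2006 Thm. 1.3 existence clause at odd `p`, whose only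
content beyond tree theorems is `p = 3`, `mazur_tate_sigma_exists_odd_iff_three`, and the proved
`exists_isCanonical_of_odd`). This file is the kit of the `p = 3` cells of the rank-2 census
(`data/padic/DIFF/DIFF_R2A.tsv` v9: 730 cells `(E, 3)`, `3` good ordinary, of which 714
`certified(H+L)` by the two engines A-3 / A-K3 and B of the cell seats padic-1/2):

* `padicRow_of_certificate_odd`, `selmerCorank_eq_of_certificate_odd`, `padicRow_of_symbolCertL_odd`:
  the row theorems of `Rank2ObservatoryPadicRow.lean` / `…SymbolTableL.lean` with `5 ≤ p` replaced by
  `p ≠ 2` and the two odd-prime named facts `hPRS`, `hσ` as hypotheses (same proofs, same conclusion: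
  `rank_ℤ E(ℚ) = r`, `ord_{T=0} L_p = r`, `Ш(E/ℚ)[p^∞]` finite, Schneider non-degeneracy for every
  canonical height datum, `corank Sel_{p^∞} = r`);
* `AtlasCell.checkOdd` (= `AtlasCell.check` with the conjunct `5 ≤ p` replaced by `p ≠ 2`; the SAME
  datum `AtlasCell`, the same `certL`, `count`, `validL`), its soundness lemmas `sound_of_checkOdd` /
  `rowInputs_of_checkOdd`, `AtlasCurve.checkOdd`,
  `AtlasCurve.padicRowOdd` (the `p`-adic row of a cell of a checking curve) and the table accessors
  `AtlasCurve.check_of_allOdd` / `…Odd₂` / `…Odd₃` (minimality by `minCheck` / `minCheck₂` / `minCheck₃`);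
* `AtlasCell.checkOdd_of_check`: a cell passing the `p ≥ 5` test passes the odd test, so the odd row
  theorem also covers every landed atlas cell.

Consumers: the machine-written parts `Rank2ObservatoryPadicAtlasP3R2A*.lean` (two-engine plus-symbol
tables at `3^n`, `3^{n+1}`: engine A = msengine numerical period sums rounded to the lattice with Hecke /
Manin checks, engine P = PARI `msfromell`/`mseval` exact; kit jobs j122805, j122806 of the cell folder;
generator `code/b2b-bsdr2-padic-2/gen6/gen_atlas_p3.py`). What is NOT claimed: nothing at `p = 2`,
nothing for supersingular or bad `p`, nothing about `ord_{s=1} L(E,s)` or `#Ш`; rank `3` at `p = 3` is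
excluded by `validL` (`3 ∣ 3!`). No new definitions of mathematical objects (two Boolean tests), no new
axioms, no `sorry`, kernel `decide` only in the consumers.

References: J. Balakrishnan, J. S. Müller, W. Stein, Math. Comp. 85 (2016), Thm. 1.7 and p. 3 ("we
assume that p > 2"); B. Mazur, W. Stein, J. Tate, Doc. Math. Extra Vol. (2006), Thm. 1.3;
J. S. Balakrishnan, J. Number Theory 161 (2016), §2; K. Kato, Astérisque 295 (2004), Thm. 17.4;
B. Mazur, J. Tate, J. Teitelbaum, Invent. Math. 84 (1986), §I.10–I.13; W. Stein, C. Wuthrich, Math.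
Comp. 82 (2013), §3; J. Cremona, Algorithms for Modular Elliptic Curves (1997), §2.13, §3.5;
J. Silverman, AEC (2009), VII.1.
-/

-- single-conjunct summit: `Summit.BirchSwinnertonDyer.BirchSwinnertonDyer.…` repeats the name by design
set_option linter.dupNamespace false

namespace Summit.BirchSwinnertonDyer.BirchSwinnertonDyer.Rank2Observatory

open scoped MatrixGroups ModularForm
open CongruenceSubgroup Literature.NumberTheory.EllipticCurves
  Literature.NumberTheory.EllipticCurves.ModularForms WeierstrassCurve
open Cruxes.PinchPrime.FirstLayerStability
  (isTorsion_and_order_charGenerator_le_order_padicLFunction_of_kato)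
open Literature.NumberTheory.Sieve.GoldbachLinnik (primeB prime_of_primeB)

/-! ### The `p`-adic row of a certified cell at an odd prime -/

/-- **The `p`-adic row of a certified census cell `(E, p)` at an ODD good ordinary prime** (as
`padicRow_of_certificate`, with `5 ≤ p` replaced by `p ≠ 2`). INPUTS as named hypotheses: `hPRS`
(Perrin-Riou–Schneider at `p > 2`, BMS Thm. 1.7 as printed), `hσ` (existence of the Mazur–Tate sigma
pair at odd `p`, MST 2006 Thm. 1.3 — gives THE canonical height datum, `exists_isCanonical_of_odd`),
`hkato` (Kato Thm. 17.4 for all cyclotomic data), `hlow : r ≤ rank_ℤ E(ℚ)`, `hLp : [T^r] L_p ≠ 0`.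
OUTPUT: `rank_ℤ E(ℚ) = r`, `ord_{T=0} L_p = r`, `Ш(E/ℚ)[p^∞]` finite, Schneider non-degeneracy for
every canonical cyclotomic `p`-adic height datum. [cite: BalakrishnanMullerStein2015, Thm. 1.7 and p. 3]
[cite: Kato2004Asterisque, Thm. 17.4 (p. 273)] [cite: MazurSteinTate2006, Thm. 1.3] -/
theorem padicRow_of_certificate_odd (hPRS : Schneider1985_order_charGenerator_odd)
    (hσ : mazur_tate_sigma_exists_odd)
    (W : WeierstrassCurve ℚ) [W.IsElliptic] [W.IsGloballyMinimal] (p : ℕ) [Fact p.Prime]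
    {N : ℕ} [NeZero N] {f : CuspForm (Gamma0 N) 2}
    (hkato : ∀ (κ : ZpExtension ℚ p) (γ : Field.absoluteGaloisGroup ℚ),
      kato_divisibility W p (κ := κ) (γ := γ) (f := f))
    (hp2 : p ≠ 2) (hord : IsOrdinaryAt W p) (hf : IsNewformOf W f)
    {r : ℕ} (hlow : r ≤ W.mordellWeilRank)
    (hLp : PowerSeries.coeff r (padicLFunction f (unitRoot W p : ℚ_[p])) ≠ 0) :
    W.mordellWeilRank = r ∧ (padicLFunction f (unitRoot W p : ℚ_[p])).order = r ∧
      Finite (AddCommGroup.primaryComponent W.sha p) ∧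
      ∀ Dh : PAdicHeightData W p, Dh.IsCanonical → SchneiderConjecture Dh := by
  obtain ⟨hr, horder⟩ := rank_eq_and_order_eq_of_certificate W p hkato hp2 hord hf hlow hLp
  -- the cyclotomic datum, the Iwasawa datum, a generator of `char X`
  obtain ⟨κ, hκ, γ, hγ, hγ'⟩ := exists_isCyclotomic_isTopGenerator_isCyclotomicVariable_holds p
  obtain ⟨D⟩ := W.nonempty_selmerDualData_holds κ γ hγ
  haveI : Module.Finite (IwasawaAlgebra p) D.X := D.module_finite_of_isCyclotomic W κ hκ hγ
  obtain ⟨fE, hfE⟩ : ∃ fE : IwasawaAlgebra p, D.charIdeal = Ideal.span {fE} := by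
    have hP : (D.charIdeal).IsPrincipal := charIdeal_isPrincipal_holds p D.X
    exact ⟨hP.generator, (Ideal.span_singleton_generator D.charIdeal).symm⟩
  obtain ⟨hX, hle⟩ := isTorsion_and_order_charGenerator_le_order_padicLFunction_of_kato W p
    (hkato κ γ) hp2 hord hκ hγ hγ' hf D fE hfE
  -- a canonical height datum exists at an odd good ordinary prime
  obtain ⟨Dh₀, hDh₀⟩ := exists_isCanonical_of_odd hσ W p hp2 hord.1 hord.2
  -- `ord f_E = rank`
  have hfEord : fE.order = W.mordellWeilRank := by
    refine le_antisymm ?_ (hPRS W p hp2 hord.1 hord.2 κ γ hκ hγ hγ' D hX fE hfE Dh₀ hDh₀).1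
    rw [hr, ← horder]
    exact hle
  have key : ∀ Dh : PAdicHeightData W p, Dh.IsCanonical →
      SchneiderConjecture Dh ∧ Finite (AddCommGroup.primaryComponent W.sha p) := fun Dh hDh ↦
    (hPRS W p hp2 hord.1 hord.2 κ γ hκ hγ hγ' D hX fE hfE Dh hDh).2.1.mp hfEord
  exact ⟨hr, horder, (key Dh₀ hDh₀).2, fun Dh hDh ↦ (key Dh hDh).1⟩

/-- **Corollary: the `p^∞`-Selmer corank of a certified cell at an odd prime is `r`**
(`corank Sel_{p^∞}(E/ℚ) = rank + corank Ш[p^∞]` and `Ш[p^∞]` is finite).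
[cite: BalakrishnanMullerStein2015, Thm. 1.7] [cite: Kato2004Asterisque, Thm. 17.4 (p. 273)] -/
theorem selmerCorank_eq_of_certificate_odd (hPRS : Schneider1985_order_charGenerator_odd)
    (hσ : mazur_tate_sigma_exists_odd)
    (W : WeierstrassCurve ℚ) [W.IsElliptic] [W.IsGloballyMinimal] (p : ℕ) [Fact p.Prime]
    {N : ℕ} [NeZero N] {f : CuspForm (Gamma0 N) 2}
    (hkato : ∀ (κ : ZpExtension ℚ p) (γ : Field.absoluteGaloisGroup ℚ),
      kato_divisibility W p (κ := κ) (γ := γ) (f := f))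
    (hp2 : p ≠ 2) (hord : IsOrdinaryAt W p) (hf : IsNewformOf W f)
    {r : ℕ} (hlow : r ≤ W.mordellWeilRank)
    (hLp : PowerSeries.coeff r (padicLFunction f (unitRoot W p : ℚ_[p])) ≠ 0) :
    W.selmerCorank p = r := by
  obtain ⟨hr, -, hfin, -⟩ := padicRow_of_certificate_odd hPRS hσ W p hkato hp2 hord hf hlow hLp
  haveI := hfin
  rw [W.selmerCorank_eq_mordellWeilRank_add_holds p, hr, WeierstrassCurve.shaCorank,
    zpCorank_eq_zero_of_finite _ p, add_zero]

/-- **The `p`-adic row from a VALID `SymbolCertL` at an odd prime** (as `padicRow_of_symbolCertL`,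
with `5 ≤ p` replaced by `p ≠ 2`, which `validL` itself tests). [cite: BalakrishnanMullerStein2015, Thm. 1.7]
[cite: Kato2004Asterisque, Thm. 17.4 (p. 273)] [cite: MazurTateTeitelbaum1986Invent, §I.10–I.13] -/
theorem padicRow_of_symbolCertL_odd (p : ℕ) [Fact p.Prime]
    (hPRS : Schneider1985_order_charGenerator_odd) (hσ : mazur_tate_sigma_exists_odd)
    (W : WeierstrassCurve ℚ) [W.IsElliptic] [W.IsGloballyMinimal] (hord : IsOrdinaryAt W p) {ap : ℤ}
    (hap : W.frobeniusTrace p = ap) {N : ℕ} [NeZero N] {f : CuspForm (Gamma0 N) 2}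
    (hf : IsNewformOf W f)
    (hkato : ∀ (κ : ZpExtension ℚ p) (γ : Field.absoluteGaloisGroup ℚ),
      kato_divisibility W p (κ := κ) (γ := γ) (f := f))
    (c : SymbolCertL) (hc : c.validL p ap = true) (hlow : c.r ≤ W.mordellWeilRank) (D : ℚ)
    (hD : ‖(D : ℚ_[p])‖ = 1) (hint : ∀ x : ℚ, ‖(ratPlusSymbol f x : ℚ_[p])‖ ≤ 1)
    (htab : ∀ u : ℕ, u < p ^ (c.n + 1) → ¬ p ∣ u →
      ratPlusSymbol f ((u : ℚ) / (p : ℚ) ^ (c.n + 1)) = (c.tabHi.getD u 0 : ℚ) / D ∧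
      ratPlusSymbol f ((u : ℚ) / (p : ℚ) ^ c.n) = (c.tabLo.getD u 0 : ℚ) / D) :
    W.mordellWeilRank = c.r ∧ (padicLFunction f (unitRoot W p : ℚ_[p])).order = c.r ∧
      Finite (AddCommGroup.primaryComponent W.sha p) ∧
      (∀ Dh : PAdicHeightData W p, Dh.IsCanonical → SchneiderConjecture Dh) ∧
      W.selmerCorank p = c.r := by
  have hp2 : p ≠ 2 := (of_decide_eq_true hc).1
  have hLp := coeff_ne_zero_of_symbolCertL p W hord hf hap c hc D hD hint htab
  obtain ⟨hr, ho, hfin, hS⟩ := padicRow_of_certificate_odd hPRS hσ W p hkato hp2 hord hf hlow hLp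
  exact ⟨hr, ho, hfin, hS, selmerCorank_eq_of_certificate_odd hPRS hσ W p hkato hp2 hord hf hlow hLp⟩

/-! ### One cell: the kernel test at an odd prime -/

namespace AtlasCell

variable (c : AtlasCell)

/-- **The kernel test of a cell at an ODD prime** against the curve's integer model `e`: `p ≠ 2`,
`p ∤ Δ(e)`, `#Ẽ(𝔽_p) = p + 1 − a_p`, `p ∤ a_p`, and `validL p a_p` of the expanded certificate (exactly
`AtlasCell.check` with `5 ≤ p` replaced by `p ≠ 2`). [folklore] -/
def checkOdd (e : WeierstrassCurve ℤ) : Bool :=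
  decide (c.p ≠ 2) && decide (¬ ((c.p : ℤ) ∣ e.Δ)) && decide ((c.count e : ℤ) = c.p + 1 - c.ap) &&
    decide (¬ ((c.p : ℤ) ∣ c.ap)) &&
    if hp : primeB c.p = true then @SymbolCertL.validL c.p ⟨prime_of_primeB hp⟩ c.ap c.certL else false

/-- A cell passing the `p ≥ 5` test `check` passes the odd test `checkOdd`. [folklore] -/
theorem checkOdd_of_check {e : WeierstrassCurve ℤ} (h : c.check e = true) : c.checkOdd e = true := by
  have h5 := five_le_of_check h
  simp only [check, Bool.and_eq_true, decide_eq_true_eq] at h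
  simp only [checkOdd, Bool.and_eq_true, decide_eq_true_eq]
  exact ⟨⟨⟨⟨by omega, h.1.1.1.2⟩, h.1.1.2⟩, h.1.2⟩, h.2⟩

section Soundness

variable {c} {e : WeierstrassCurve ℤ}

/-- **The decidable content of an odd-checking cell** (one lemma, all conjuncts): `p` prime, `p ≠ 2`,
`p ∤ Δ(e)`, `#Ẽ(𝔽_p) = p + 1 − a_p` (kernel count), `p ∤ a_p`. [folklore] -/
theorem sound_of_checkOdd (h : c.checkOdd e = true) :
    c.p.Prime ∧ c.p ≠ 2 ∧ ¬ ((c.p : ℤ) ∣ e.Δ) ∧ (c.count e : ℤ) = c.p + 1 - c.ap ∧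
      ¬ ((c.p : ℤ) ∣ c.ap) := by
  simp only [checkOdd, Bool.and_eq_true, decide_eq_true_eq] at h
  obtain ⟨⟨⟨⟨h2, hΔ⟩, hcount⟩, hap⟩, hv⟩ := h
  refine ⟨?_, h2, hΔ, hcount, hap⟩
  by_cases hp : primeB c.p = true
  · exact prime_of_primeB hp
  · rw [dif_neg hp] at hv; exact absurd hv Bool.false_ne_true

/-- **The row inputs of an odd-checking cell** (one lemma): the cell's `a_p` IS the Frobenius trace of
`e ⊗ ℚ` (kernel point count `= #Ẽ(𝔽_p)` by `natCard_point_eq_one_add_eulerAffineCount`, `p ≠ 2`), `p`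
is good ORDINARY for `e ⊗ ℚ`, and the expanded certificate is `validL`.
[cite: SilvermanAEC2009, VII.1 Remark 1.1] -/
theorem rowInputs_of_checkOdd (h : c.checkOdd e = true) [Fact c.p.Prime]
    [(e.baseChange ℚ).IsGloballyMinimal] :
    (e.baseChange ℚ).frobeniusTrace c.p = c.ap ∧ IsOrdinaryAt (e.baseChange ℚ) c.p ∧
      c.certL.validL c.p c.ap = true := by
  obtain ⟨-, h2, hΔ, hcount, hap⟩ := sound_of_checkOdd h
  have hv : c.certL.validL c.p c.ap = true := by
    simp only [checkOdd, Bool.and_eq_true] at h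
    by_cases hp : primeB c.p = true
    · have h' := h.2
      rw [dif_pos hp] at h'
      exact h'
    · rw [dif_neg hp] at h; exact absurd h.2 Bool.false_ne_true
  have hΔ' : (e.map (Int.castRingHom (ZMod c.p))).Δ ≠ 0 := by
    rw [WeierstrassCurve.map_Δ, eq_intCast, ne_eq, ZMod.intCast_zmod_eq_zero_iff_dvd]
    exact hΔ
  have hcard : Nat.card ((e.map (Int.castRingHom (ZMod c.p))).toAffine.Point) = c.count e := by
    rw [natCard_point_eq_one_add_eulerAffineCount c.p h2 _ hΔ']
    rfl
  have htr : (e.baseChange ℚ).frobeniusTrace c.p = c.ap := by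
    rw [frobeniusTrace_baseChange_int _ hcard]
    omega
  refine ⟨htr, ?_, hv⟩
  refine isOrdinaryAt_baseChange_int_of_card c.p e hΔ hcard ?_
  rw [← frobeniusTrace_baseChange_int _ hcard, htr]
  exact hap

end Soundness

end AtlasCell

/-! ### One curve at an odd prime -/

namespace AtlasCurve

variable (C : AtlasCurve)

/-- **The kernel test of a curve at an odd prime**: `Δ ≠ 0` and every cell passes `checkOdd` against
the integer model. [folklore] -/
def checkOdd : Bool :=
  decide (C.e.Δ ≠ 0) && C.cells.all fun c => c.checkOdd C.e

variable {C}

/-- A curve passing `check` passes `checkOdd`. [folklore] -/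
theorem checkOdd_of_check (h : C.check = true) : C.checkOdd = true := by
  simp only [check, Bool.and_eq_true, List.all_eq_true] at h
  simp only [checkOdd, Bool.and_eq_true, List.all_eq_true]
  exact ⟨h.1, fun c hc => AtlasCell.checkOdd_of_check c (h.2 c hc)⟩

/-- An odd-checking curve is elliptic. [folklore] -/
theorem isElliptic_odd (h : C.checkOdd = true) : (C.e.baseChange ℚ).IsElliptic := by
  simp only [checkOdd, Bool.and_eq_true, decide_eq_true_eq] at h
  exact isElliptic_baseChange_int _ h.1

/-- Every cell of an odd-checking curve passes `checkOdd`. [folklore] -/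
theorem cell_checkOdd (h : C.checkOdd = true) {c : AtlasCell} (hc : c ∈ C.cells) :
    c.checkOdd C.e = true := by
  simp only [checkOdd, Bool.and_eq_true, List.all_eq_true] at h
  exact h.2 c hc

/-- The prime of a cell of an odd-checking curve is prime. [folklore] -/
theorem prime_of_mem_odd (h : C.checkOdd = true) {c : AtlasCell} (hc : c ∈ C.cells) : c.p.Prime :=
  (AtlasCell.sound_of_checkOdd (cell_checkOdd h hc)).1

/-- **The `p`-adic row of an atlas cell at an odd prime.** For an odd-checking curve `C` and a cell
`c ∈ C.cells` (`p = c.p`, in the parts `p = 3`): GIVEN `hPRS` (Perrin-Riou–Schneider at `p > 2`, BMS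
Thm. 1.7), `hσ` (Mazur–Tate sigma pair at odd `p`, MST 2006 Thm. 1.3), `hkato` (Kato Thm. 17.4 for all
cyclotomic data), the newform `hf`, the census rank certificate `hlow : 2 ≤ rank row.curve`, and the
symbol DATA `hint`/`htab` (`p`-integral plus symbols; the tabulated numerators are `D·[u/p^{n+1}]⁺` and
`D·[u/p^n]⁺` at the unit residues, `‖D‖_p = 1`): `rank = 2`, `ord_{T=0} L_p = 2`, `Ш[p^∞]` finite,
Schneider non-degeneracy at `p` for every canonical height datum, `corank Sel_{p^∞} = 2`.
[cite: BalakrishnanMullerStein2015, Thm. 1.7 and p. 3] [cite: Kato2004Asterisque, Thm. 17.4 (p. 273)]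
[cite: MazurTateTeitelbaum1986Invent, §I.10–I.13] [cite: MazurSteinTate2006, Thm. 1.3] -/
theorem padicRowOdd (h : C.checkOdd = true) {c : AtlasCell} (hc : c ∈ C.cells) [Fact c.p.Prime]
    [(C.e.baseChange ℚ).IsElliptic] [(C.e.baseChange ℚ).IsGloballyMinimal]
    (hPRS : Schneider1985_order_charGenerator_odd) (hσ : mazur_tate_sigma_exists_odd)
    {N : ℕ} [NeZero N] {f : CuspForm (Gamma0 N) 2} (hf : IsNewformOf (C.e.baseChange ℚ) f)
    (hkato : ∀ (κ : ZpExtension ℚ c.p) (γ : Field.absoluteGaloisGroup ℚ),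
      kato_divisibility (C.e.baseChange ℚ) c.p (κ := κ) (γ := γ) (f := f))
    (hlow : 2 ≤ C.row.curve.mordellWeilRank) (D : ℚ) (hD : ‖(D : ℚ_[c.p])‖ = 1)
    (hint : ∀ x : ℚ, ‖(ratPlusSymbol f x : ℚ_[c.p])‖ ≤ 1)
    (htab : ∀ u : ℕ, u < c.p ^ (c.n + 1) → ¬ c.p ∣ u →
      ratPlusSymbol f ((u : ℚ) / (c.p : ℚ) ^ (c.n + 1)) = (c.tabHi.getD u 0 : ℚ) / D ∧
      ratPlusSymbol f ((u : ℚ) / (c.p : ℚ) ^ c.n) = (c.tabLo.getD (u % c.p ^ c.n) 0 : ℚ) / D) :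
    C.row.curve.mordellWeilRank = 2 ∧
      (padicLFunction f (unitRoot (C.e.baseChange ℚ) c.p : ℚ_[c.p])).order = 2 ∧
      Finite (AddCommGroup.primaryComponent (C.e.baseChange ℚ).sha c.p) ∧
      (∀ Dh : PAdicHeightData (C.e.baseChange ℚ) c.p, Dh.IsCanonical → SchneiderConjecture Dh) ∧
      (C.e.baseChange ℚ).selmerCorank c.p = 2 := by
  have hk : c.checkOdd C.e = true := cell_checkOdd h hc
  have hlow' : c.certL.r ≤ (C.e.baseChange ℚ).mordellWeilRank := by
    rw [baseChange_e]; exact hlow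
  have htab' : ∀ u : ℕ, u < c.p ^ (c.certL.n + 1) → ¬ c.p ∣ u →
      ratPlusSymbol f ((u : ℚ) / (c.p : ℚ) ^ (c.certL.n + 1)) = (c.certL.tabHi.getD u 0 : ℚ) / D ∧
      ratPlusSymbol f ((u : ℚ) / (c.p : ℚ) ^ c.certL.n) = (c.certL.tabLo.getD u 0 : ℚ) / D :=
    fun u hu hpu => by
      rw [AtlasCell.certL_tabLo_getD c hu]
      exact htab u hu hpu
  obtain ⟨hap, hord, hv⟩ := AtlasCell.rowInputs_of_checkOdd (e := C.e) hk
  obtain ⟨hr, ho, hfin, hS, hsel⟩ := padicRow_of_symbolCertL_odd c.p hPRS hσ (C.e.baseChange ℚ)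
    hord hap hf hkato c.certL hv hlow' D hD hint htab'
  exact ⟨by rw [← baseChange_e]; exact hr, ho, hfin, hS, hsel⟩

/-- From a table theorem `atlas.all (checkOdd ∧ minCheck) = true` to the two tests of a member.
[folklore] -/
theorem check_of_allOdd {atlas : List AtlasCurve}
    (h : atlas.all (fun C => C.checkOdd && C.minCheck) = true) {C : AtlasCurve} (hC : C ∈ atlas) :
    C.checkOdd = true ∧ C.minCheck = true := by
  simp only [List.all_eq_true, Bool.and_eq_true] at h
  exact h C hC

/-- From a table theorem `atlas.all (checkOdd ∧ minCheck₂) = true` to the two tests of a member.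
[folklore] -/
theorem check_of_allOdd₂ {atlas : List AtlasCurve}
    (h : atlas.all (fun C => C.checkOdd && C.minCheck₂) = true) {C : AtlasCurve} (hC : C ∈ atlas) :
    C.checkOdd = true ∧ C.minCheck₂ = true := by
  simp only [List.all_eq_true, Bool.and_eq_true] at h
  exact h C hC

/-- From a table theorem `atlas.all (checkOdd ∧ minCheck₃) = true` to the two tests of a member.
[folklore] -/
theorem check_of_allOdd₃ {atlas : List AtlasCurve}
    (h : atlas.all (fun C => C.checkOdd && C.minCheck₃) = true) {C : AtlasCurve} (hC : C ∈ atlas) :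
    C.checkOdd = true ∧ C.minCheck₃ = true := by
  simp only [List.all_eq_true, Bool.and_eq_true] at h
  exact h C hC

end AtlasCurve

end Summit.BirchSwinnertonDyer.BirchSwinnertonDyer.Rank2Observatory
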